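import Summits.QuantumFields.BalabanUV.T4Continuum.Support.VariationalColourTaxiTowerOneMin
import Summits.QuantumFields.BalabanUV.T4Continuum.Support.VariationalColourTaxiTowerFrameUB
import Summits.QuantumFields.BalabanUV.T4Continuum.Support.VariationalVectorOneMinCentredBracket

/-!
# T⁴ programme, spine node NE2 (U1a), lane P2 — THE COURIER: (ONE-min) WITH BACKGROUND AT BAŁABAN's TAXI DATA, the END's `hONEm k` of parts 6–8 with NO (ONE-min)
# shape displayed — leaf-01-g9's `hONEm_centred_reg` plugged BY NAME into the bridge (item «ONE-MIN AT TAXI DATA — THE COMPOSITE-FIBRE ↔ TAXI-FRAME BRIDGE»,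
# file 6; model level; cell `pub-balaban`)

NE2 formalisation swarm `b2b-balaban-t4-ne2-formalise-*`, leaf prover 04 GEN 7 (`prover-b2b-balaban-t4-ne2-formalise-leaf-04-g7-0`); register row «P2-sup» of
`t4/formal/NE2/LEAVES.md`; journal CLAIMS.log INTENT 2026-08-20 l.21025, bridge LANDED l.21849.  Composition BY NAME of leaf-01-g9's `VariationalVectorOneMinCentredReg.
hONEm_centred_reg` (p235562; (ONE-min) with background for the componentwise centred competitor, composite fibre, frame-adapted carriers) with this lineage's
`VariationalColourTaxiTowerOneMin.hONEm_taxi_of_centred` (p237760; the bridge), `VariationalColourTaxiTowerFrameUB.hUBfV_taxi` (file 5; the supplier's fine V-UB at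
taxi data, k-uniform), part 6's `VariationalColourTaxiTowerProjG.{hPc_projG_nestLv, hGar_projG_nestLv}` and gen 4's taxi lemmas `norm_misv_taxi_le`, `hin_taxiTv_le`,
`hcross_taxiTv_le` (`VariationalColourTaxiTransport` ∕ `…TaxiLines`).  Nothing defined.

THE STATEMENT ([folklore]; `E = ℂ`; level `k` fixed; letters of parts 6–8).  **`hONEm_taxi`**: at Bałaban's taxi data (coherent tower of UNITARY one-step bonds `R′ k`,
plaquette class `b k`, level bonds `Rlev k` with plaquette class `a`), GIVEN — (i) the colour scalar pair's leaves UB⁺ ∕ fine-UB⁺ ∕ P⁺ (both levels) ∕ REG⁺ at the taxi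
frames (`T := taxiTv (L^k) M (Rlev k)`, `T′ := taxiTv L _ (R′ k)`) with constants `Λ, C_P, C_R` (DISPLAYED; supplier: leaf-09-g3's `colour_pair_closed` chain at the taxi
classes — next file); (ii) V-REG for `G := projG (Rlev k) (ker Q_T)` on the carriers `QvL (nestLv k)` with constant `C_Rᵛ` (DISPLAYED; part 8's `projG_sockets_nestLv` under the
class); (iii) (GF3)_k and (GF3)_{k+1} for the straight-taxi kernels (DISPLAYED, part 6's letters; part 7 under the regular presentation); (iv) the level-k and level-(k+1)
class ∕ smallness lines of parts 4 ∕ 10 and file 5's `κᵥ⁻¹γ_F < 1`; (v) free `s, t, u, u₂, w > 0` and the two transfer smallness lines of file 4b — THEN the END's socket at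
level `k`: `∀ φ W₀, Q_k W₀ = φ → IsMin → ∃ g, Q_k(Q₂ g) = φ ∧ SfV (R′ k) G₂′ g ≤ (√(S + ε₁(S + nsqV φ)) + δ′₁√(qWV W₀))²` with `Q₂ = QvL L _ (lineT L _ T′ (R′ k))`,
`G₂′ = projG (Rlev (k+1)) (ker Q_{taxiTv (Rlev (k+1))}) ∘ (· ∘ sites)`, `ε₁ = (A−1) + A·ε⋆ + B`, `δ′₁ = √A·√(8d(1+d²))·(L^k·L·m₁)`, `ε⋆` = leaf-01-g9's explicit `ε` at the
taxi sizes `p := a`, `m := (d−1)L(L−1)b_k`, `m₁ := (d−1)(L−1)(2L−1)b_k`, V-P ∕ (Går) constants of part 6 §1, `Λᵥ` = file 5's, and `A, B` = file 3's.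
WHAT IS DISCHARGED HERE (not displayed any more): the (ONE-min) shape itself, the frames' unitarity, the transport mismatch `m`, the one-step defects `m₁` (`hin` ∕ `hcross`),
the vector V-P ∕ (Går) for `G` (part 6 §1), the vector fine V-UB for the supplier's composite fibre (file 5), the END-side fine V-UB ∕ V-P ∕ kernel swap ∕ carrier defect
(files 2–4).  WHAT STAYS DISPLAYED, WITH ITS SUPPLIER: (i) colour leaves — next file; (ii) V-REG — part 8; (iii) (GF3) — part 7; (iv)–(v) numerics ∕ class.

HONEST FRAMING (T4-DAG p. 1).  Rung (B)+1 only — NOT infinite volume, NOT a mass gap, NOT Clay.  NE2 NOT IN PRINT, NOT proved here.  MODEL LEVEL (c5): bond ∕ site operators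
DATA, taxi contours, carriers, both gauge fixings and the centred competitor OURS; bookkeeping over landed leaves ([folklore]); thresholds via `revPC` quantitatively void;
nothing with background is discharged as an END statement; V-END with background ∕ NE2 NOT proved; NE3 OPEN; spine PROVED 0∕9 unchanged.  HONEST DEPENDENCY (cell, verbatim):
continuum YM on T⁴ ⇐ BetaPertH ∧ nine spine estimates (0/9 proved); BetaPertH ⇐ (D1) ∧ (D4) ∧ CAP+tail; G-an2-4 gates asym, D1 and NE2/3/4.
-/

noncomputable section

namespace Summit.QuantumFields.BalabanUV.T4Continuum.VariationalColourTaxiTransport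

open Finset
open Literature.MathematicalPhysics.QuantumFieldTheory.Balaban1983to89.B5Prop11Plancherel (Tor fine unitVec)
open Literature.MathematicalPhysics.QuantumFieldTheory.Balaban1983to89.B5Block118 (bpt)
open Literature.MathematicalPhysics.QuantumFieldTheory.Balaban1983to89.B5Composition116 (sites)
open Summit.QuantumFields.BalabanUV.T4Continuum.VariationalColourFederbush (misv norm_le_one_of_mem_unitary)
open Summit.QuantumFields.BalabanUV.T4Continuum.VariationalColourTower (Rtrv)
open Summit.QuantumFields.BalabanUV.T4Continuum.VariationalColourUpperBound (nsqv)
open Summit.QuantumFields.BalabanUV.T4Continuum.VariationalColourOneStepPhys (rhov)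
open Summit.QuantumFields.BalabanUV.T4Continuum.VariationalColourScalarPair (Scv Sfv qWv qVv Qkv Q1v)
open Summit.QuantumFields.BalabanUV.T4Continuum.VariationalVectorFederbush (lineT)
open Summit.QuantumFields.BalabanUV.T4Continuum.VariationalVectorInterpolant (frameT)
open Summit.QuantumFields.BalabanUV.T4Continuum.VectorBlockTrialForm (nsqV nsqV_nonneg QvL roughV kappaV)
open Summit.QuantumFields.BalabanUV.T4Continuum.VariationalVectorForm (ScV SfV qWV qVV lamV lamV_nonneg)
open Summit.QuantumFields.BalabanUV.T4Continuum.VariationalVectorWeitzenbock (divSq)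
open Summit.QuantumFields.BalabanUV.T4Continuum.VariationalVectorGaugeSlice (avgOp projG projG_nonneg)
open Summit.QuantumFields.BalabanUV.T4Continuum.VariationalVectorOneStepPhys (rhoV)
open Summit.QuantumFields.BalabanUV.T4Continuum.CovariantBlockReversePoincare (revPC revPC_nonneg)
open Summit.QuantumFields.BalabanUV.T4Continuum.VariationalVectorOneMinCentredReg (hONEm_centred_reg)
open Summit.QuantumFields.BalabanUV.T4Continuum.VariationalVectorOneMinCentredBracket (epsStar_nonneg)

variable {d : ℕ}
variable (L : ℕ) [NeZero L] (M : Fin d → ℕ) [hM : ∀ μ, NeZero (M μ)]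
variable {R' : (k : ℕ) → Tor (fine L (fine (L ^ k) M)) → Fin d → (ℂ →L[ℂ] ℂ)} (hU : ∀ k x μ, R' k x μ ∈ unitary (ℂ →L[ℂ] ℂ)) {b : ℕ → ℝ}
  (hb : ∀ k x κ ι, ‖R' k x κ * R' k (x + unitVec (fine L (fine (L ^ k) M)) κ) ι - R' k x ι * R' k (x + unitVec (fine L (fine (L ^ k) M)) ι) κ‖ ≤ b k)
  (hcoh : ∀ k, coarseTv L (fine (L ^ (k + 1)) M) (R' (k + 1)) = Rtrv (L ^ k) L M (R' k))
include hU hb hcoh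

/-- **(ONE-min) WITH BACKGROUND AT BAŁABAN's TAXI DATA — THE END's `hONEm k` WITH NO (ONE-min) SHAPE DISPLAYED** (see the module docstring for the letters, the
displayed leaves and their suppliers; `eH, e₂, ε` are leaf-01-g9's `let`s at the taxi sizes, `v, γ, Λf, A, B` file 4b's). [folklore] -/
theorem hONEm_taxi (hd : 1 ≤ d) (hM2 : ∀ μ, 1 < M μ) (k : ℕ) {a : ℝ} (ha0 : 0 ≤ a)
    (ha : ∀ x κ ι, ‖Rlev L M R' k x κ * Rlev L M R' k (x + unitVec (fine (L ^ k) M) κ) ι - Rlev L M R' k x ι * Rlev L M R' k (x + unitVec (fine (L ^ k) M) ι) κ‖ ≤ a)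
    (hb0 : 0 ≤ b k)
    -- the level-k class ∕ smallness lines (part 10's rough Poincaré at level k)
    (hsmallk : 2 * (d : ℝ) * ((((L ^ k : ℕ) : ℝ)) * (((d - 1 : ℕ) : ℝ) * ((L ^ k - 1 : ℕ) : ℝ) * a)) ^ 2 ≤ 1 / 2)
    (hγsk : 64 * (∑ q ∈ Finset.range k, ((((d - 1 : ℕ) : ℝ) + (d : ℝ) * d) * (((L : ℝ) * ((L ^ q - 1 : ℕ) : ℝ) * ((L - 1 : ℕ) : ℝ)) * b q))) ^ 2 ≤ 1)
    (hsmall80k : 2 * 40 * ((d : ℝ) * ((((L ^ k : ℕ) : ℝ)) ^ 2 * a)) ≤ 1)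
    -- the level-(k+1) class ∕ smallness lines (parts 4 ∕ 10) and file 5's
    (hsmall : 2 * (d : ℝ) * ((((L ^ (k + 1) : ℕ) : ℝ)) * (((d - 1 : ℕ) : ℝ) * ((L ^ (k + 1) - 1 : ℕ) : ℝ) * b k)) ^ 2 ≤ 1 / 2)
    (hγs : 64 * (∑ q ∈ Finset.range (k + 1), ((((d - 1 : ℕ) : ℝ) + (d : ℝ) * d) * (((L : ℝ) * ((L ^ q - 1 : ℕ) : ℝ) * ((L - 1 : ℕ) : ℝ)) * b q))) ^ 2 ≤ 1)
    (hsmall80 : 2 * 40 * ((d : ℝ) * ((((L ^ (k + 1) : ℕ) : ℝ)) ^ 2 * b k)) ≤ 1)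
    (hc : (kappaV d (L ^ (k + 1)))⁻¹ * ((∑ q ∈ Finset.range (k + 1), ((((d - 1 : ℕ) : ℝ) + (d : ℝ) * d) * (((L : ℝ) * ((L ^ q - 1 : ℕ) : ℝ) * ((L - 1 : ℕ) : ℝ)) * b q)))
              + 3 * (((d - 1 : ℕ) : ℝ) * (L ^ (k + 1) : ℕ) * ((L ^ (k + 1) - 1 : ℕ) : ℝ) * b k)) < 1)
    (hcF : (kappaV d (L ^ k * L))⁻¹ * ((∑ q ∈ Finset.range k, ((((d - 1 : ℕ) : ℝ) + (d : ℝ) * d) * (((L : ℝ) * ((L ^ q - 1 : ℕ) : ℝ) * ((L - 1 : ℕ) : ℝ)) * b q))) + 3 * (((d - 1 : ℕ) : ℝ) * (L ^ k : ℕ) * ((L ^ k - 1 : ℕ) : ℝ) * a) + ((d - 1 : ℕ) : ℝ) * ((L ^ k - 1 : ℕ) : ℝ) * ((2 * L ^ k - 1 : ℕ) : ℝ) * a) < 1)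
    -- the DISPLAYED (GF3)_k and (GF3)_(k+1) for the straight-taxi kernels (part 6's letters)
    {CD CD' CD₁ CD₁' : ℝ} (hCD : 0 ≤ CD) (hCD' : 0 ≤ CD') (hCD₁ : 0 ≤ CD₁) (hCD₁' : 0 ≤ CD₁')
    (hGdivk : ∀ W, ((((L ^ k : ℕ) : ℝ)) ^ d)⁻¹ * ((((L ^ k : ℕ) : ℝ)) ^ 2 * divSq (fine (L ^ k) M) (Rlev L M R' k) W)
      ≤ CD * ScV (L ^ k) M (Rlev L M R' k) (projG (fine (L ^ k) M) (Rlev L M R' k) (LinearMap.ker (avgOp (L ^ k) M (taxiTv (L ^ k) M (Rlev L M R' k))))) W + CD' * nsqV M (QvL (L ^ k) M (nestLv L M R' k) W))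
    (hGdiv : ∀ W, ((((L ^ (k + 1) : ℕ) : ℝ)) ^ d)⁻¹ * ((((L ^ (k + 1) : ℕ) : ℝ)) ^ 2 * divSq (fine (L ^ (k + 1)) M) (Rlev L M R' (k + 1)) W)
      ≤ CD₁ * ScV (L ^ (k + 1)) M (Rlev L M R' (k + 1)) (projG (fine (L ^ (k + 1)) M) (Rlev L M R' (k + 1))
          (LinearMap.ker (avgOp (L ^ (k + 1)) M (taxiTv (L ^ (k + 1)) M (Rlev L M R' (k + 1)))))) W
        + CD₁' * nsqV M (QvL (L ^ (k + 1)) M (nestLv L M R' (k + 1)) W))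
    -- the DISPLAYED colour scalar pair's leaves at the taxi frames (supplier: the `colour_pair_closed` chain, next file)
    {Λ CP CR : ℝ} (hΛ : 0 ≤ Λ) (hCP : 0 ≤ CP) (hCR : 0 ≤ CR)
    (hUBc : ∀ ψ : Tor M → ℂ, ∃ f, Qkv (L ^ k) M (taxiTv (L ^ k) M (Rlev L M R' k)) f = ψ ∧ Scv (L ^ k) M (Rlev L M R' k) f ≤ Λ * nsqv ψ)
    (hUBf : ∀ ψ : Tor M → ℂ, ∃ g, Qkv (L ^ k) M (taxiTv (L ^ k) M (Rlev L M R' k)) (Q1v (L ^ k) L M (taxiTv L (fine (L ^ k) M) (R' k)) g) = ψ ∧ Sfv (L ^ k) L M (R' k) g ≤ Λ * nsqv ψ)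
    (hPc : ∀ f, qWv (L ^ k) M f ≤ CP * (Scv (L ^ k) M (Rlev L M R' k) f + nsqv (Qkv (L ^ k) M (taxiTv (L ^ k) M (Rlev L M R' k)) f)))
    (hPf : ∀ g, qVv (L ^ k) L M g ≤ CP * (Sfv (L ^ k) L M (R' k) g + nsqv (Qkv (L ^ k) M (taxiTv (L ^ k) M (Rlev L M R' k)) (Q1v (L ^ k) L M (taxiTv L (fine (L ^ k) M) (R' k)) g))))
    (hREG : ∀ (ψ : Tor M → ℂ) f, Qkv (L ^ k) M (taxiTv (L ^ k) M (Rlev L M R' k)) f = ψ → (∀ f₂, Qkv (L ^ k) M (taxiTv (L ^ k) M (Rlev L M R' k)) f₂ = ψ → Scv (L ^ k) M (Rlev L M R' k) f ≤ Scv (L ^ k) M (Rlev L M R' k) f₂) →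
      rhov (L ^ k) M (Rlev L M R' k) f ≤ CR * (Scv (L ^ k) M (Rlev L M R' k) f + nsqv ψ))
    -- the DISPLAYED V-REG for `G` on the carriers `QvL (nestLv k)` (supplier: part 8's `projG_sockets_nestLv` under the class)
    {CRv : ℝ} (hCRv : 0 ≤ CRv)
    (hREGV : ∀ (φ : Tor M → Fin d → ℂ) W, QvL (L ^ k) M (nestLv L M R' k) W = φ →
      (∀ W₂, QvL (L ^ k) M (nestLv L M R' k) W₂ = φ → ScV (L ^ k) M (Rlev L M R' k) (projG (fine (L ^ k) M) (Rlev L M R' k) (LinearMap.ker (avgOp (L ^ k) M (taxiTv (L ^ k) M (Rlev L M R' k))))) W ≤ ScV (L ^ k) M (Rlev L M R' k) (projG (fine (L ^ k) M) (Rlev L M R' k) (LinearMap.ker (avgOp (L ^ k) M (taxiTv (L ^ k) M (Rlev L M R' k))))) W₂) →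
      rhoV (L ^ k) M (Rlev L M R' k) W ≤ CRv * (ScV (L ^ k) M (Rlev L M R' k) (projG (fine (L ^ k) M) (Rlev L M R' k) (LinearMap.ker (avgOp (L ^ k) M (taxiTv (L ^ k) M (Rlev L M R' k))))) W + nsqV M φ))
    -- free parameters and the two transfer smallness lines
    {s t u u₂ w : ℝ} (hs : 0 < s) (ht : 0 < t) (hu : 0 < u) (hu₂ : 0 < u₂) (hw : 0 < w)
    (hv : (1 + u₂⁻¹) * (4 * ((d : ℝ) * ((d : ℝ) * (((L : ℝ) * ((L ^ k - 1 : ℕ) : ℝ) * ((L - 1 : ℕ) : ℝ)) * b k)))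
          * revPC d (L ^ k * L) (((d - 1 : ℕ) : ℝ) * ((L - 1 : ℕ) : ℝ) * ((2 * L - 1 : ℕ) : ℝ) * b k + ((d - 1 : ℕ) : ℝ) * ((L ^ k - 1 : ℕ) : ℝ) * a)) ^ 2
        * ((d : ℝ) * ((2 * (1 + CD₁)) + (2 * (CD₁' + d * ((((L ^ (k + 1) : ℕ) : ℝ)) ^ 2 * b k) * 64)))) ≤ 1 / 8)
    (hγ : (3 * (((d - 1 : ℕ) : ℝ) * L * ((L - 1 : ℕ) : ℝ) * b k)) ^ 2 * max (40 * (2 * (1 + CD₁))) (64 + 40 * (2 * (CD₁' + d * ((((L ^ (k + 1) : ℕ) : ℝ)) ^ 2 * b k) * 64))) ≤ 1 / 4) :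
    let eH : ℝ := (((d : ℝ) / 4 + 1 / 2) * ((L : ℝ) / ((L ^ k : ℕ) : ℝ) ^ 2)) * CR * (Λ + 1)
        + 2 * (Real.sqrt (2 * d * (1 + (d : ℝ) ^ 2)) * (((L ^ k : ℕ) : ℝ) * L * (((d - 1 : ℕ) : ℝ) * ((L - 1 : ℕ) : ℝ) * ((2 * L - 1 : ℕ) : ℝ) * b k)))
          * Real.sqrt ((Λ + (((d : ℝ) / 4 + 1 / 2) * ((L : ℝ) / ((L ^ k : ℕ) : ℝ) ^ 2)) * CR * (Λ + 1)) * (CP * (Λ + 1)))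
        + (Real.sqrt (2 * d * (1 + (d : ℝ) ^ 2)) * (((L ^ k : ℕ) : ℝ) * L * (((d - 1 : ℕ) : ℝ) * ((L - 1 : ℕ) : ℝ) * ((2 * L - 1 : ℕ) : ℝ) * b k))) ^ 2 * (CP * (Λ + 1))
        + 2 * (Real.sqrt d * (((L ^ k : ℕ) : ℝ) * (((d - 1 : ℕ) : ℝ) * L * ((L - 1 : ℕ) : ℝ) * b k))) * Real.sqrt (Λ * (CP * (Λ + 1)))
    let e₂ : ℝ := t + 3 * (1 + t⁻¹) * (8 * d * ((((L ^ k : ℕ) : ℝ) ^ 2)⁻¹ * CRv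
          + (1 + (((d - 1 : ℕ) : ℝ) * ((L - 1 : ℕ) : ℝ) * ((2 * L - 1 : ℕ) : ℝ) * b k)) ^ 2 * ((d : ℝ) / 4 * L * ((((L ^ k : ℕ) : ℝ) ^ 2)⁻¹ * CRv)) + (((d - 1 : ℕ) : ℝ) * ((L - 1 : ℕ) : ℝ) * ((2 * L - 1 : ℕ) : ℝ) * b k) ^ 2 * ((2 * (1 + CD)) + (2 * (CD' + d * ((((L ^ k : ℕ) : ℝ)) ^ 2 * a) * 64)))
          + (((d - 1 : ℕ) : ℝ) * ((L - 1 : ℕ) : ℝ) * ((2 * L - 1 : ℕ) : ℝ) * b k) ^ 2 * (2 * (1 + (d : ℝ) ^ 2) * (L : ℝ) ^ 2 * (((L ^ k : ℕ) : ℝ) ^ 2 * (max (40 * (2 * (1 + CD))) (64 + 40 * (2 * (CD' + d * ((((L ^ k : ℕ) : ℝ)) ^ 2 * a) * 64)))))))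
        + (d : ℝ) / 2 * (2 * d * ((((L ^ k : ℕ) : ℝ) ^ 2)⁻¹ * CRv) + 2 * (d : ℝ) ^ 2 * a ^ 2 * (((L ^ k : ℕ) : ℝ) ^ 2 * (max (40 * (2 * (1 + CD))) (64 + 40 * (2 * (CD' + d * ((((L ^ k : ℕ) : ℝ)) ^ 2 * a) * 64))))))
        + (d : ℝ) / 4 * (2 * (2 * d * ((((L ^ k : ℕ) : ℝ) ^ 2)⁻¹ * CRv) + 2 * (d : ℝ) ^ 2 * a ^ 2 * (((L ^ k : ℕ) : ℝ) ^ 2 * (max (40 * (2 * (1 + CD))) (64 + 40 * (2 * (CD' + d * ((((L ^ k : ℕ) : ℝ)) ^ 2 * a) * 64)))))) + 2 * (Λ * (((L ^ k : ℕ) : ℝ) ^ 2)⁻¹ * (CD + CD')))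
        + CP * eH * (CD + CD'))
    let ε : ℝ := u + (1 + u) * ((s + (1 + s⁻¹) * (d * (L : ℝ) / ((L ^ k : ℕ) : ℝ) ^ 2)) * (1 + CRv) + e₂)
      + (1 + u⁻¹) * ((lamV d ((L ^ k * L : ℕ) * (((d - 1 : ℕ) : ℝ) * ((L - 1 : ℕ) : ℝ) * ((2 * L - 1 : ℕ) : ℝ) * b k + ((d - 1 : ℕ) : ℝ) * ((L ^ k - 1 : ℕ) : ℝ) * a)) d (((L ^ k * L : ℕ) : ℝ) ^ 2 * 0) / (1 - (kappaV d (L ^ k * L))⁻¹ * ((∑ q ∈ Finset.range k, ((((d - 1 : ℕ) : ℝ) + (d : ℝ) * d) * (((L : ℝ) * ((L ^ q - 1 : ℕ) : ℝ) * ((L - 1 : ℕ) : ℝ)) * b q))) + 3 * (((d - 1 : ℕ) : ℝ) * (L ^ k : ℕ) * ((L ^ k - 1 : ℕ) : ℝ) * a) + ((d - 1 : ℕ) : ℝ) * ((L ^ k - 1 : ℕ) : ℝ) * ((2 * L ^ k - 1 : ℕ) : ℝ) * a)) ^ 2) * (25 / 4 * ((((L ^ k : ℕ) : ℝ) ^ 2)⁻¹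 * ((2 * (1 + CD)) + (2 * (CD' + d * ((((L ^ k : ℕ) : ℝ)) ^ 2 * a) * 64))))))
    let δ' : ℝ := Real.sqrt (8 * d * (1 + (d : ℝ) ^ 2)) * (((L ^ k : ℕ) : ℝ) * L * (((d - 1 : ℕ) : ℝ) * ((L - 1 : ℕ) : ℝ) * ((2 * L - 1 : ℕ) : ℝ) * b k))
    let v : ℝ := (1 + u₂⁻¹) * (4 * ((d : ℝ) * ((d : ℝ) * (((L : ℝ) * ((L ^ k - 1 : ℕ) : ℝ) * ((L - 1 : ℕ) : ℝ)) * b k)))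
          * revPC d (L ^ k * L) (((d - 1 : ℕ) : ℝ) * ((L - 1 : ℕ) : ℝ) * ((2 * L - 1 : ℕ) : ℝ) * b k + ((d - 1 : ℕ) : ℝ) * ((L ^ k - 1 : ℕ) : ℝ) * a)) ^ 2
        * ((d : ℝ) * ((2 * (1 + CD₁)) + (2 * (CD₁' + d * ((((L ^ (k + 1) : ℕ) : ℝ)) ^ 2 * b k) * 64))))
    let γ : ℝ := (3 * (((d - 1 : ℕ) : ℝ) * L * ((L - 1 : ℕ) : ℝ) * b k)) ^ 2 * max (40 * (2 * (1 + CD₁))) (64 + 40 * (2 * (CD₁' + d * ((((L ^ (k + 1) : ℕ) : ℝ)) ^ 2 * b k) * 64)))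
    let Λf : ℝ := lamV d ((L ^ (k + 1) : ℕ) * (((d - 1 : ℕ) : ℝ) * ((L ^ (k + 1) - 1 : ℕ) : ℝ) * b k)) d (((L ^ (k + 1) : ℕ) : ℝ) ^ 2 * 0)
          / (1 - (kappaV d (L ^ (k + 1)))⁻¹ * ((∑ q ∈ Finset.range (k + 1), ((((d - 1 : ℕ) : ℝ) + (d : ℝ) * d) * (((L : ℝ) * ((L ^ q - 1 : ℕ) : ℝ) * ((L - 1 : ℕ) : ℝ)) * b q)))
              + 3 * (((d - 1 : ℕ) : ℝ) * (L ^ (k + 1) : ℕ) * ((L ^ (k + 1) - 1 : ℕ) : ℝ) * b k))) ^ 2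
    let A : ℝ := (1 + w + (1 + w⁻¹) * (Λf * γ) * (1 + 4 * γ)) * (1 + 4 * v) * (1 + u₂)
    let B : ℝ := (1 + w + (1 + w⁻¹) * (Λf * γ) * (1 + 4 * γ)) * (1 + 4 * v) * (4 * v) + 4 * ((1 + w⁻¹) * (Λf * γ))
    ∀ (φ : Tor M → Fin d → ℂ) (W₀ : Tor (fine (L ^ k) M) → Fin d → ℂ), QvL (L ^ k) M (nestLv L M R' k) W₀ = φ →
      (∀ W, QvL (L ^ k) M (nestLv L M R' k) W = φ → ScV (L ^ k) M (Rlev L M R' k) (projG (fine (L ^ k) M) (Rlev L M R' k) (LinearMap.ker (avgOp (L ^ k) M (taxiTv (L ^ k) M (Rlev L M R' k))))) W₀ ≤ ScV (L ^ k) M (Rlev L M R' k) (projG (fine (L ^ k) M) (Rlev L M R' k) (LinearMap.ker (avgOp (L ^ k) M (taxiTv (L ^ k) M (Rlev L M R' k))))) W) →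
      ∃ g, QvL (L ^ k) M (nestLv L M R' k) (QvL L (fine (L ^ k) M) (lineT L (fine (L ^ k) M) (taxiTv L (fine (L ^ k) M) (R' k)) (R' k)) g) = φ ∧
        SfV (L ^ k) L M (R' k)
            (fun W' => projG (fine (L ^ (k + 1)) M) (Rlev L M R' (k + 1)) (LinearMap.ker (avgOp (L ^ (k + 1)) M (taxiTv (L ^ (k + 1)) M (Rlev L M R' (k + 1))))) (W' ∘ sites (L ^ k) L M)) g
          ≤ (Real.sqrt (ScV (L ^ k) M (Rlev L M R' k) (projG (fine (L ^ k) M) (Rlev L M R' k) (LinearMap.ker (avgOp (L ^ k) M (taxiTv (L ^ k) M (Rlev L M R' k))))) W₀ + ((A - 1) + A * ε + B) * (ScV (L ^ k) M (Rlev L M R' k) (projG (fine (L ^ k) M) (Rlev L M R' k) (LinearMap.ker (avgOp (L ^ k) M (taxiTv (L ^ k) M (Rlev L M R' k))))) W₀ + nsqV M φ))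
              + (Real.sqrt A * δ') * Real.sqrt (qWV (L ^ k) M W₀)) ^ 2 := by
  intro eH e₂ ε δ'
  have hR'all : ∀ k x μ, ‖R' k x μ‖ ≤ 1 := fun k x μ => norm_le_one_of_mem_unitary (hU k x μ)
  have hUk : ∀ x μ, Rlev L M R' k x μ ∈ unitary (ℂ →L[ℂ] ℂ) := Rlev_mem_unitary L M hU k
  have hT : ∀ x, (taxiTv (L ^ k) M (Rlev L M R' k)) x ∈ unitary (ℂ →L[ℂ] ℂ) := taxiTv_mem_unitary (L ^ k) M hUk
  have hT' : ∀ x, (taxiTv L (fine (L ^ k) M) (R' k)) x ∈ unitary (ℂ →L[ℂ] ℂ) := taxiTv_mem_unitary L (fine (L ^ k) M) (hU k)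
  have hTk : ∀ y j t' μ, ‖(nestLv L M R' k) y j t' μ‖ ≤ 1 := norm_nestLv_le_one L M hR'all k
  have hC : coarseTv L (fine (L ^ k) M) (R' k) = Rlev L M R' k := coarseTv_eq_Rlev L M R' hcoh k
  -- the taxi sizes `m`, `m₁`
  have hm0 : (0 : ℝ) ≤ (((d - 1 : ℕ) : ℝ) * L * ((L - 1 : ℕ) : ℝ) * b k) := by positivity
  have hm₁0 : (0 : ℝ) ≤ (((d - 1 : ℕ) : ℝ) * ((L - 1 : ℕ) : ℝ) * ((2 * L - 1 : ℕ) : ℝ) * b k) := by positivity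
  have hmis : ∀ y μ j, ‖misv L (fine (L ^ k) M) (Rlev L M R' k) (R' k) (taxiTv L (fine (L ^ k) M) (R' k)) y μ j‖ ≤ (((d - 1 : ℕ) : ℝ) * L * ((L - 1 : ℕ) : ℝ) * b k) := by
    intro y μ j
    have h := norm_misv_taxi_le L (fine (L ^ k) M) (hR'all k) (hb k) y μ j
    rw [hC] at h
    exact h
  have hin : ∀ (y : Tor (fine (L ^ k) M)) (j : Fin d → Fin L) (μ : Fin d), (j μ : ℕ) + 1 < L →
      ‖R' k (bpt L (fine (L ^ k) M) y j) μ * star ((taxiTv L (fine (L ^ k) M) (R' k)) (bpt L (fine (L ^ k) M) y j + unitVec (fine L (fine (L ^ k) M)) μ)) - star ((taxiTv L (fine (L ^ k) M) (R' k)) (bpt L (fine (L ^ k) M) y j))‖ ≤ (((d - 1 : ℕ) : ℝ) * ((L - 1 : ℕ) : ℝ) * ((2 * L - 1 : ℕ) : ℝ) * b k) := by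
    intro y j μ hj
    refine (hin_taxiTv_le L (fine (L ^ k) M) (hU k) (hb k) y j μ hj).trans ?_
    have hL1 : (1 : ℝ) ≤ ((2 * L - 1 : ℕ) : ℝ) := by
      have := NeZero.pos L
      exact_mod_cast (by omega : 1 ≤ 2 * L - 1)
    have h0 : 0 ≤ ((d - 1 : ℕ) : ℝ) * ((L - 1 : ℕ) : ℝ) * b k := by positivity
    calc ((d - 1 : ℕ) : ℝ) * ((L - 1 : ℕ) : ℝ) * b k = (((d - 1 : ℕ) : ℝ) * ((L - 1 : ℕ) : ℝ) * b k) * 1 := (mul_one _).symm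
      _ ≤ (((d - 1 : ℕ) : ℝ) * ((L - 1 : ℕ) : ℝ) * b k) * ((2 * L - 1 : ℕ) : ℝ) := mul_le_mul_of_nonneg_left hL1 h0
      _ = ((d - 1 : ℕ) : ℝ) * ((L - 1 : ℕ) : ℝ) * ((2 * L - 1 : ℕ) : ℝ) * b k := by ring
  have hcross : ∀ (y : Tor (fine (L ^ k) M)) (j : Fin d → Fin L) (μ : Fin d), (j μ : ℕ) + 1 = L →
      ‖R' k (bpt L (fine (L ^ k) M) y j) μ * star ((taxiTv L (fine (L ^ k) M) (R' k)) (bpt L (fine (L ^ k) M) y j + unitVec (fine L (fine (L ^ k) M)) μ))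
        - star ((taxiTv L (fine (L ^ k) M) (R' k)) (bpt L (fine (L ^ k) M) y j)) * (Rlev L M R' k) y μ‖ ≤ (((d - 1 : ℕ) : ℝ) * ((L - 1 : ℕ) : ℝ) * ((2 * L - 1 : ℕ) : ℝ) * b k) := by
    intro y j μ hj
    have h := hcross_taxiTv_le L (fine (L ^ k) M) (hU k) (hb k) y j μ hj
    rw [hC] at h
    exact h
  -- part 6 §1: V-P and (Går) for `G` on the carriers (from (GF3)_k)
  have hPcV := fun W => hPc_projG_nestLv L M hU hb hcoh hM2 k ha0 ha hsmallk hγsk hsmall80k _ hGdivk W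
  have hGar := fun W => hGar_projG_nestLv L M hU hb hcoh hM2 k ha0 ha hsmallk hγsk hsmall80k _ hGdivk W
  have hCGar : (0 : ℝ) ≤ (2 * (1 + CD)) := by positivity
  have hCGar' : (0 : ℝ) ≤ (2 * (CD' + d * ((((L ^ k : ℕ) : ℝ)) ^ 2 * a) * 64)) := by positivity
  have hCPv : (0 : ℝ) ≤ (max (40 * (2 * (1 + CD))) (64 + 40 * (2 * (CD' + d * ((((L ^ k : ℕ) : ℝ)) ^ 2 * a) * 64)))) := le_max_of_le_left (by positivity)
  -- file 5: the supplier's fine V-UB, k-uniform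
  have hΛv : (0 : ℝ) ≤ (lamV d ((L ^ k * L : ℕ) * (((d - 1 : ℕ) : ℝ) * ((L - 1 : ℕ) : ℝ) * ((2 * L - 1 : ℕ) : ℝ) * b k + ((d - 1 : ℕ) : ℝ) * ((L ^ k - 1 : ℕ) : ℝ) * a)) d (((L ^ k * L : ℕ) : ℝ) ^ 2 * 0) / (1 - (kappaV d (L ^ k * L))⁻¹ * ((∑ q ∈ Finset.range k, ((((d - 1 : ℕ) : ℝ) + (d : ℝ) * d) * (((L : ℝ) * ((L ^ q - 1 : ℕ) : ℝ) * ((L - 1 : ℕ) : ℝ)) * b q))) + 3 * (((d - 1 : ℕ) : ℝ) * (L ^ k : ℕ) * ((L ^ k - 1 : ℕ) : ℝ) * a) + ((d - 1 : ℕ) : ℝ) * ((L ^ k - 1 : ℕ) : ℝ) * ((2 * L ^ k - 1 : ℕ) : ℝ) * a)) ^ 2) :=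
    div_nonneg (lamV_nonneg (Nat.cast_nonneg d) (mul_nonneg (sq_nonneg _) le_rfl)) (sq_nonneg _)
  have hUBfV := hUBfV_taxi L M hU hb hcoh hd k ha0 ha hb0 hcF
  -- `ε⋆ ≥ 0` (leaf-01-g9) and `δ′ ≥ 0`
  have hε : 0 ≤ ε := epsStar_nonneg (L ^ k) L (p := a) hm0 hm₁0 hΛ hCP hCR hΛv hCRv hCPv hCGar hCGar' hCD hCD' hs ht hu
  have hδ' : 0 ≤ δ' := by positivity
  -- the bridge with leaf-01-g9's (ONE-min) with background plugged in (`nsqV φ` for `nsqV (Q_k W₀)`)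
  exact hONEm_taxi_of_centred L M hU hb hcoh hd hM2 k ha0 ha hb0 hsmall hγs hsmall80 hc hCD₁ hCD₁' hGdiv (ε := ε) (δ' := δ') hε hδ'
    (fun φ W₀ hW₀ hmin => by
      obtain ⟨g, hg, h⟩ := hONEm_centred_reg (L ^ k) L M hd (Rc := Rlev L M R' k) (R' := R' k) (T := (taxiTv (L ^ k) M (Rlev L M R' k))) (T' := (taxiTv L (fine (L ^ k) M) (R' k))) (Tk := (nestLv L M R' k))
        hT hT' hUk (hU k) hTk ha0 ha hm0 hmis hm₁0 hin hcross hΛ hCP hCR hUBc hUBf hPc hPf hREG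
        hΛv hCGar hCGar' hCD hCD' hUBfV hPcV hGar hGdivk hREGV hs ht hu φ W₀ hW₀ hmin
      rw [hW₀] at h
      exact ⟨g, hg, h⟩) hu₂ hw hv hγ

end Summit.QuantumFields.BalabanUV.T4Continuum.VariationalColourTaxiTransport

end
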